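import Mathlib
import HarnessLib
import Summits.ValiantsHypothesis.ValiantsHypothesis.Theses.MonotoneRestoration
import Literature.Computability.AlgebraicComplexity.ArithCircuit
import Literature.Computability.AlgebraicComplexity.ArithCircuitProofs
import Literature.Computability.AlgebraicComplexity.MonotoneStructure
import Literature.Computability.AlgebraicComplexity.PermanentIrreducible
import Literature.ModelTheory.FiniteModelTheory.CkEquiv
import Summits.ValiantsHypothesis.ValiantsHypothesis.Theorems.MonotoneRestorationMonotoneRestorationQPCosetCount
import Summits.ValiantsHypothesis.ValiantsHypothesis.Theorems.MonotoneRestorationMonotoneRestorationQPSymmetricLB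
import Summits.ValiantsHypothesis.ValiantsHypothesis.Theorems.MonotoneRestorationMonotoneRestorationQPSupportSymmetrisation
import Summits.ValiantsHypothesis.ValiantsHypothesis.Theorems.MonotoneRestorationMonotoneRestorationQPSparseRegime
import Summits.ValiantsHypothesis.ValiantsHypothesis.Theorems.MonotoneRestorationMonotoneRestorationQPBeta
import Literature.Computability.AlgebraicComplexity.SymmetricArithCircuit
import Literature.Computability.AlgebraicComplexity.DawarWilsenach2025Proofs
import Literature.GroupTheory.PermutationGroups.SmallIndexSubgroups
import Summits.ValiantsHypothesis.ValiantsHypothesis.Theorems.MonotoneRestorationQP.Negative.LoadBearing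
import Summits.ValiantsHypothesis.ValiantsHypothesis.Theorems.MonotoneRestorationMonotoneRestorationQPPermSupportCount
import Literature.Barriers.PneNP.AlgebrizationProofs

/-! TTRL-lite variant V19301 of stmt-ValiantsHypothesis-15886 -/

set_option linter.dupNamespace false

namespace Summit.ValiantsHypothesis.ValiantsHypothesis.Theorems

open Summit.ValiantsHypothesis.ValiantsHypothesis.Theses.MonotoneRestoration
open Literature.Computability.AlgebraicComplexity

/-- TTRL-lite variant V19301 (explicit-threshold form `[G0x]` of the polynomial-vs-exponential
step of the registered stub `stub_gammaArithmetic` of `stmt-ValiantsHypothesis-15886`):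
`m ^ d ≤ 2 ^ m` as soon as `4 ^ d ≤ m`.  With `k = ⌊log₂ m⌋` one has `2d ≤ k`, hence
`m ^ d < 2 ^ ((k + 1) d)` and `(k + 1) d ≤ k (k + 1) / 2 ≤ 2 ^ k ≤ m`; this is exactly the landed
folklore lemma `Literature.Barriers.PneNP.AW56.pow_le_two_pow`, which we reuse. -/
theorem stub_gammaArithmetic_var19301 : ∀ (d m : ℕ), 4 ^ d ≤ m → m ^ d ≤ 2 ^ m :=
  fun _d _m h => Literature.Barriers.PneNP.AW56.pow_le_two_pow h

end Summit.ValiantsHypothesis.ValiantsHypothesis.Theorems
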